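import Literature.AlgebraicGeometry.Motives.CartierDivisorSectionsOn
import Literature.Algebra.Homology.OrderedCech
import Mathlib.AlgebraicGeometry.Morphisms.Flat
import Mathlib.AlgebraicGeometry.Morphisms.Separated
import HarnessLib

/-!
# The ordered Čech complex of `𝒪_X(D)` over an affine open of the base (Görtz–Wedhorn II, (21.15), (22.2))

Let `pr : Y → B` be a morphism of schemes with `Y` integral, `D = (U_i, f_i)` a Cartier divisor on
`Y` (`Motives/CartierDivisor`) and `V ⊆ B` an open subset with `A = Γ(V, 𝒪_B)`. A **Čech cover**
of `(pr, D)` over `V` (`CartierDivisor.CechCover`) is a finite family `W_0, …, W_r` of non-empty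
affine opens of `Y_V = pr⁻¹V` covering it, each contained in a chart `U_{c(a)}` of `D`. To it we
attach the family `s ↦ Γ(W_s, 𝒪_Y(D)) ⊆ K(Y)`, `W_s = pr⁻¹V ∩ ⋂_{a ∈ s} W_a`
(`CechCover.sectionsOn`, from `Motives/CartierDivisorSectionsOn`; it is monotone in `s`, all
`W_s` being non-empty since `Y` is irreducible), and hence the **ordered Čech complex**
`Č•(𝔚, 𝒪_Y(D)|_{Y_V})` of `A`-modules (`CechCover.complex`, an instance of
`Literature/Algebra/Homology/OrderedCech`; Görtz–Wedhorn II, Def. 21.68), `A` acting through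
`Γ(V, 𝒪_B) → Γ(pr⁻¹V, 𝒪_Y) → K(Y)` (`CartierDivisor.baseAlgebra`).

PROVED here: the complex is concentrated in degrees `[0, r]`, and when `V` is affine and `pr` is
flat and separated its terms are **flat** `A`-modules (`CechCover.flat_complex_X`): the
intersections `W_s` are affine (`pr` has affine diagonal, Mathlib `isAffineHom_diagonal_iff`),
`Γ(W_s, 𝒪_Y)` is flat over `Γ(V, 𝒪_B)` (Mathlib `HasRingHomProperty.appLE` for `@Flat`), and
`Γ(W_s, 𝒪_Y(D)) ≅ Γ(W_s, 𝒪_Y)` (`CartierDivisor.flat_sectionsOn`). By Görtz–Wedhorn II,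
Thm. 22.9 this complex computes `RΓ(Y_V, 𝒪_Y(D))`, i.e. `Rpr_*𝒪_Y(D)` over the affine `V`; that
identification, and the perfectness of `Rpr_*𝒪_Y(D)` for `pr` proper (Cor. 23.135), are NOT
proved here — they are the named facts of `Motives/GrothendieckComplexCech`, stated about this
complex. Mathlib searched (pin): `isAffineHom_diagonal_iff`, `HasRingHomProperty.appLE`,
`Scheme.Hom.appLE`, `Scheme.Hom.appLE_map`, `Opens.coe_finset_inf` (used); no Čech complex of
a quasi-coherent module on a scheme exists in Mathlib.

## References

* U. Görtz, T. Wedhorn, *Algebraic Geometry II: Cohomology of Schemes*, Springer Spektrum (2023),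
  doi:10.1007/978-3-658-43031-3: (21.14)–(21.15), Def. 21.64, Def. 21.68, pp. 258–260; (22.2)
  Thm. 22.9 and Cor. 22.10, p. 332 (read via the held copy). [GortzWedhorn2023]
* U. Görtz, T. Wedhorn, *Algebraic Geometry I: Schemes*, 2nd ed. (2020): (11.9), pp. 373–374
  (`𝒪_X(D)`). [GortzWedhorn2020]
-/

universe u

open CategoryTheory CategoryTheory.Limits AlgebraicGeometry TopologicalSpace Opposite

noncomputable section

namespace Literature.AlgebraicGeometry.Motives

open RatFn

namespace CartierDivisor

variable {Y B : Scheme.{u}} [IsIntegral Y] (pr : Y ⟶ B) (V : B.Opens)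

/-! ### The base ring `Γ(V, 𝒪_B)` acting on `K(Y)` and on sections over opens of `pr⁻¹V` -/

/-- The `Γ(V, 𝒪_B)`-algebra structure on `K(Y)` through `Γ(V, 𝒪_B) → Γ(pr⁻¹V, 𝒪_Y) → K(Y)`
(germ at the generic point; `pr⁻¹V` non-empty). A `def`, to be activated with `letI`.
[folklore] -/
abbrev baseAlgebra (hV : genericPoint Y ∈ pr ⁻¹ᵁ V) : Algebra Γ(B, V) Y.functionField :=
  ((Y.presheaf.germ (pr ⁻¹ᵁ V) (genericPoint Y) hV).hom.comp (pr.app V).hom).toAlgebra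

/-- The structure map of `baseAlgebra`: `a ↦` the rational function of `pr^♯(a) ∈ Γ(pr⁻¹V, 𝒪_Y)`.
[folklore] -/
theorem baseAlgebra_algebraMap (hV : genericPoint Y ∈ pr ⁻¹ᵁ V) (a : Γ(B, V)) :
    letI := baseAlgebra pr V hV
    algebraMap Γ(B, V) Y.functionField a = ofSection hV (pr.app V a) := rfl

/-- The elements of `Γ(V, 𝒪_B)` act on `K(Y)` by functions regular on `pr⁻¹V`. [folklore] -/
theorem isRegularAt_baseAlgebra_algebraMap (hV : genericPoint Y ∈ pr ⁻¹ᵁ V) (a : Γ(B, V)) {y : Y}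
    (hy : y ∈ pr ⁻¹ᵁ V) :
    letI := baseAlgebra pr V hV
    IsRegularAt y (algebraMap Γ(B, V) Y.functionField a) :=
  isRegularAt_ofSection hy _

/-- The `Γ(V, 𝒪_B)`-algebra structure on `Γ(W, 𝒪_Y)` for an open `W ⊆ pr⁻¹V`, through
`pr^♯ : Γ(V, 𝒪_B) → Γ(W, 𝒪_Y)` (Mathlib `Scheme.Hom.appLE`). A `def`, to be activated with `letI`.
[folklore] -/
abbrev secAlgebra (W : Y.Opens) (hW : W ≤ pr ⁻¹ᵁ V) : Algebra Γ(B, V) Γ(Y, W) :=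
  (pr.appLE V W hW).hom.toAlgebra

/-- Compatibility of `secAlgebra` and `baseAlgebra`: the rational function of `pr^♯(a)|_W` is that
of `pr^♯(a)`. [folklore] -/
theorem ofSection_secAlgebra_algebraMap (hV : genericPoint Y ∈ pr ⁻¹ᵁ V) (W : Y.Opens)
    (hW : W ≤ pr ⁻¹ᵁ V) (hξ : genericPoint Y ∈ W) (a : Γ(B, V)) :
    letI := baseAlgebra pr V hV
    letI := secAlgebra pr V W hW
    ofSection hξ (algebraMap Γ(B, V) Γ(Y, W) a) = algebraMap Γ(B, V) Y.functionField a := by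
  letI := baseAlgebra pr V hV
  letI := secAlgebra pr V W hW
  change ofSection hξ ((pr.app V ≫ Y.presheaf.map (homOfLE hW).op) a) = ofSection hV (pr.app V a)
  rw [CommRingCat.comp_apply]
  exact ofSection_map (homOfLE hW) hξ _

/-! ### Čech covers of `(pr, D)` over an open of the base -/

variable (D : CartierDivisor Y)

/-- **A Čech cover of `(pr : Y → B, D)` over the open `V ⊆ B`**: finitely many non-empty affine
opens `W_0, …, W_r` of `pr⁻¹V` covering it, each inside a chart `U_{c(a)}` of the Cartier divisor
`D` (so that `𝒪_Y(D)|_{W_a} = f_{c(a)}⁻¹ 𝒪_{W_a}`). This is the datum of an affine open covering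
of `Y_V` as used for the (ordered) Čech complex of a quasi-coherent module (Görtz–Wedhorn II,
(21.14), (22.2)), refined so as to trivialise `𝒪_Y(D)`. [folklore] -/
structure CechCover where
  /-- `W_0, …, W_r`. -/
  r : ℕ
  /-- The opens of the cover. -/
  W : Fin (r + 1) → Y.Opens
  /-- They lie over `V`. -/
  W_le : ∀ a, W a ≤ pr ⁻¹ᵁ V
  /-- They are affine. -/
  isAffineOpen_W : ∀ a, IsAffineOpen (W a)
  /-- They are non-empty (equivalently: contain the generic point). -/
  genericPoint_mem_W : ∀ a, genericPoint Y ∈ W a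
  /-- A chart of `D` containing `W_a`. -/
  chart : Fin (r + 1) → D.ι
  /-- `W_a ⊆ U_{c(a)}`. -/
  W_le_U : ∀ a, W a ≤ D.U (chart a)
  /-- The `W_a` cover `pr⁻¹V`. -/
  iSup_W : ⨆ a, W a = pr ⁻¹ᵁ V

namespace CechCover

variable {pr V D} (𝔚 : CechCover pr V D)

/-- The generic point of `Y` lies over `V` (the cover has the member `W_0 ∋ ξ`). [folklore] -/
theorem genericPoint_mem (𝔚 : CechCover pr V D) : genericPoint Y ∈ pr ⁻¹ᵁ V :=
  𝔚.W_le 0 (𝔚.genericPoint_mem_W 0)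

/-- The intersections `W_s = pr⁻¹V ∩ ⋂_{a ∈ s} W_a` indexed by finite sets of indices
(`W_∅ = pr⁻¹V`). [folklore] -/
def opens (s : Finset (Fin (𝔚.r + 1))) : Y.Opens := pr ⁻¹ᵁ V ⊓ s.inf 𝔚.W

/-- `W_s ⊆ pr⁻¹V`. [folklore] -/
theorem opens_le (s : Finset (Fin (𝔚.r + 1))) : 𝔚.opens s ≤ pr ⁻¹ᵁ V := inf_le_left

/-- `W_s` shrinks as `s` grows. [folklore] -/
theorem opens_anti {s t : Finset (Fin (𝔚.r + 1))} (h : s ⊆ t) : 𝔚.opens t ≤ 𝔚.opens s :=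
  inf_le_inf_left _ (Finset.inf_mono h)

/-- `W_s ⊆ W_a` for `a ∈ s`. [folklore] -/
theorem opens_le_W {s : Finset (Fin (𝔚.r + 1))} {a : Fin (𝔚.r + 1)} (ha : a ∈ s) :
    𝔚.opens s ≤ 𝔚.W a :=
  inf_le_right.trans (Finset.inf_le ha)

/-- Membership in `W_s`. [folklore] -/
theorem mem_opens_iff {s : Finset (Fin (𝔚.r + 1))} {y : Y} :
    y ∈ 𝔚.opens s ↔ y ∈ pr ⁻¹ᵁ V ∧ ∀ a ∈ s, y ∈ 𝔚.W a := by
  classical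
  have key : ∀ t : Finset (Fin (𝔚.r + 1)), y ∈ t.inf 𝔚.W ↔ ∀ a ∈ t, y ∈ 𝔚.W a := by
    intro t
    induction t using Finset.induction_on with
    | empty => simp
    | insert a t hat ih => rw [Finset.inf_insert, Opens.mem_inf, ih, Finset.forall_mem_insert]
  unfold opens
  rw [Opens.mem_inf, key]

/-- **All `W_s` are non-empty**: they contain the generic point of the irreducible scheme `Y`
(so that restriction in `𝒪_Y(D) ⊆ 𝒦_Y` is injective and the ordered Čech complex is a complex
of submodules of `K(Y)`). [folklore] -/
theorem genericPoint_mem_opens (s : Finset (Fin (𝔚.r + 1))) : genericPoint Y ∈ 𝔚.opens s :=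
  𝔚.mem_opens_iff.2 ⟨𝔚.genericPoint_mem, fun a _ => 𝔚.genericPoint_mem_W a⟩

/-- **The `W_s` (`s ≠ ∅`) are affine** when `V` is affine and `pr` is separated: `pr` has affine
diagonal, so intersections of affine opens lying over the affine `V` are affine (Görtz–Wedhorn II,
(22.2): for a separated scheme the finite intersections of affine opens are affine; Mathlib
`isAffineHom_diagonal_iff`). [cite: GortzWedhorn2023, Thm. 22.9, proof and Rem. 22.12 (pp. 332–333)] -/
theorem isAffineOpen_opens [IsSeparated pr] (hV : IsAffineOpen V) {s : Finset (Fin (𝔚.r + 1))}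
    (hs : s.Nonempty) : IsAffineOpen (𝔚.opens s) := by
  classical
  have key := isAffineHom_diagonal_iff.mp (inferInstance : IsAffineHom (pullback.diagonal pr)) V hV
  induction s using Finset.induction_on with
  | empty => exact absurd hs Finset.not_nonempty_empty
  | insert a s has ih =>
    by_cases hs' : s.Nonempty
    · have e : 𝔚.opens (insert a s) = 𝔚.W a ⊓ 𝔚.opens s := by
        unfold opens
        rw [Finset.inf_insert]
        ext1
        simp only [Opens.coe_inf]
        rw [Set.inter_left_comm]
      rw [e]
      exact key _ (𝔚.W_le a) _ (𝔚.opens_le s) (𝔚.isAffineOpen_W a) (ih hs')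
    · rw [Finset.not_nonempty_iff_eq_empty] at hs'
      subst hs'
      have e : 𝔚.opens (insert a ∅) = 𝔚.W a := by
        unfold opens
        rw [Finset.insert_empty, Finset.inf_singleton]
        exact inf_eq_right.2 (𝔚.W_le a)
      rw [e]
      exact 𝔚.isAffineOpen_W a

/-! ### The family `s ↦ Γ(W_s, 𝒪_Y(D))` and its ordered Čech complex -/

/-- **`Γ(W_s, 𝒪_Y(D)) ⊆ K(Y)`** as a `Γ(V, 𝒪_B)`-submodule (through `baseAlgebra`).
[cite: GortzWedhorn2020, Section (11.9) (p. 374)] -/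
def sectionsOn (s : Finset (Fin (𝔚.r + 1))) :
    letI := baseAlgebra pr V 𝔚.genericPoint_mem
    Submodule Γ(B, V) Y.functionField :=
  letI := baseAlgebra pr V 𝔚.genericPoint_mem
  D.sectionsOn (𝔚.opens s) fun a _ hy =>
    isRegularAt_baseAlgebra_algebraMap pr V 𝔚.genericPoint_mem a (𝔚.opens_le s hy)

/-- Membership in `Γ(W_s, 𝒪_Y(D))`. [folklore] -/
theorem mem_sectionsOn_iff {s : Finset (Fin (𝔚.r + 1))} {f : Y.functionField} :
    f ∈ 𝔚.sectionsOn s ↔ D.IsSectionOn (𝔚.opens s : Set Y) f := Iff.rfl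

/-- **Restriction is inclusion**: `s ⊆ t ⇒ Γ(W_s, 𝒪_Y(D)) ⊆ Γ(W_t, 𝒪_Y(D))` inside `K(Y)`; the
family is monotone, as `Literature/Algebra/Homology/OrderedCech` requires. [folklore] -/
theorem sectionsOn_mono : Monotone 𝔚.sectionsOn := fun _ _ h =>
  letI := baseAlgebra pr V 𝔚.genericPoint_mem
  CartierDivisor.sectionsOn_mono (𝔚.opens_anti h) _ _

/-- **The ordered Čech complex `Č•(𝔚, 𝒪_Y(D)|_{pr⁻¹V})`** of `Γ(V, 𝒪_B)`-modules
(Görtz–Wedhorn II, Def. 21.68, for the covering `(W_a)` of `pr⁻¹V` and the sheaf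
`𝒪_Y(D) ⊆ 𝒦_Y`): `Čⁿ = Π_{#s = n+1} Γ(W_s, 𝒪_Y(D))`,
`(d g)_s = Σ_{a ∈ s} ± g_{s ∖ a}|_{W_s}`. [cite: GortzWedhorn2023, Def. 21.68 (p. 260)] -/
def complex : CochainComplex (ModuleCat.{u} Γ(B, V)) ℤ :=
  letI := baseAlgebra pr V 𝔚.genericPoint_mem
  Literature.Algebra.Homology.OrderedCech.complex 𝔚.sectionsOn 𝔚.sectionsOn_mono

/-- The complex is concentrated in degrees `≥ 0`. [folklore] -/
theorem isStrictlyGE_complex : 𝔚.complex.IsStrictlyGE 0 :=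
  letI := baseAlgebra pr V 𝔚.genericPoint_mem
  Literature.Algebra.Homology.OrderedCech.isStrictlyGE_complex _ _

/-- The complex is concentrated in degrees `≤ r` (Görtz–Wedhorn II, Cor. 21.70).
[cite: GortzWedhorn2023, Cor. 21.70 (p. 260)] -/
theorem isStrictlyLE_complex : 𝔚.complex.IsStrictlyLE 𝔚.r := by
  letI := baseAlgebra pr V 𝔚.genericPoint_mem
  have h := Literature.Algebra.Homology.OrderedCech.isStrictlyLE_complex 𝔚.sectionsOn
    𝔚.sectionsOn_mono
  rw [Fintype.card_fin] at h
  have e : ((𝔚.r + 1 : ℕ) : ℤ) - 1 = (𝔚.r : ℤ) := by push_cast; ring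
  rw [e] at h
  exact h

/-! ### Flatness of the terms -/

/-- **`Γ(W_s, 𝒪_Y(D))` is a flat `Γ(V, 𝒪_B)`-module** (`s ≠ ∅`, `V` affine, `pr` flat and
separated): `W_s` is affine and flat over `V`, so `Γ(W_s, 𝒪_Y)` is a flat `Γ(V, 𝒪_B)`-algebra
(flatness is affine-local, Mathlib `HasRingHomProperty` for `@Flat`), and
`Γ(W_s, 𝒪_Y(D)) ≅ Γ(W_s, 𝒪_Y)` through the chart `U_{c(a)} ⊇ W_a ⊇ W_s`, `a ∈ s`
(`CartierDivisor.sectionsOnEquiv`; cf. Mumford, *Abelian Varieties*, §5: the Čech complex of an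
`S`-flat coherent module with respect to an affine cover over an affine base consists of flat
modules). [folklore] -/
theorem flat_sectionsOn [Flat pr] [IsSeparated pr] (hV : IsAffineOpen V)
    {s : Finset (Fin (𝔚.r + 1))} (hs : s.Nonempty) :
    letI := baseAlgebra pr V 𝔚.genericPoint_mem
    Module.Flat Γ(B, V) (𝔚.sectionsOn s) := by
  letI := baseAlgebra pr V 𝔚.genericPoint_mem
  letI := secAlgebra pr V (𝔚.opens s) (𝔚.opens_le s)
  obtain ⟨a, ha⟩ := hs
  haveI : Module.Flat Γ(B, V) Γ(Y, 𝔚.opens s) :=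
    HasRingHomProperty.appLE (P := @Flat) pr inferInstance ⟨V, hV⟩
      ⟨𝔚.opens s, 𝔚.isAffineOpen_opens hV ⟨a, ha⟩⟩ (𝔚.opens_le s)
  exact CartierDivisor.flat_sectionsOn (𝔚.genericPoint_mem_opens s)
    ((𝔚.opens_le_W ha).trans (𝔚.W_le_U a))
    (ofSection_secAlgebra_algebraMap pr V 𝔚.genericPoint_mem _ (𝔚.opens_le s)
      (𝔚.genericPoint_mem_opens s)) _

/-- **The terms of `Č•(𝔚, 𝒪_Y(D)|_{pr⁻¹V})` are flat `Γ(V, 𝒪_B)`-modules** (`V` affine, `pr`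
flat and separated). [folklore] -/
theorem flat_complex_X [Flat pr] [IsSeparated pr] (hV : IsAffineOpen V) (n : ℤ) :
    Module.Flat Γ(B, V) (𝔚.complex.X n) := by
  letI := baseAlgebra pr V 𝔚.genericPoint_mem
  change Module.Flat Γ(B, V)
    (Literature.Algebra.Homology.OrderedCech.Cochain 𝔚.sectionsOn n)
  exact Literature.Algebra.Homology.OrderedCech.flat_cochain _ (fun s hs => 𝔚.flat_sectionsOn hV hs) n

end CechCover

end CartierDivisor

end Literature.AlgebraicGeometry.Motives

end
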